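import Summits.Ventures.LatticeQCDFlow.Exactness.ReversibleComparison
import HarnessLib

/-!
# Random MIXTURES of exact reversible updates inherit the best component up to its weight: `τ_mix + ½ ≤ (τ₁ + ½)/a` and `≤ (τ₂ + ½)/(1 − a)` for every observable

HONEST FRAMING: exact (Metropolis-corrected) sampling algorithms for lattice gauge theory;
figures of merit are autocorrelation/cost numbers at stated couplings and volumes; no
continuum-physics claim.  (SCALAR calibration rung S0-A: not a gauge result.)

Venture `LatticeQCDFlow` (cell pub-lqcd), topic `Exactness`; FANOUT row 2 (`s0-phi4`).  NEW WORK
of the cell over `Exactness/ReversibleComparison.lean` (the comparison theorem in Abel form) in the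
`RevOp` format.  Nothing is cited as a fact; elementary.  Printed counterparts NAMED ONLY: mixtures
and cycles of MCMC kernels (Tierney 1994, Ann. Statist. 22, §2.4 "hybrid" strategies); the
Dirichlet form of a mixture is the mixture of the Dirichlet forms (folklore).

THE POINT.  Two exact reversible samplers `K₁`, `K₂` of the SAME target on the same admissible class
(a flow proposal with its accept/reject step and an HMC trajectory; a local sweep and a global move;
two flows; two trajectory lengths — `Exactness/Phi4HMCRandomisedComparison.lean` is the special case
of row 2's randomised HMC), and the MIXTURE `M = a K₁ + (1 − a) K₂` ("at every update toss an
`a`-coin and apply `K₁` or `K₂`"), given as any operator with `M f x = a K₁ f x + (1 − a) K₂ f x`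
pointwise (hypothesis `hM`; no definition added).  Then `𝓔_M = a 𝓔₁ + (1 − a) 𝓔₂ ≥ a 𝓔₁`, so the
comparison theorem gives, for EVERY observable of the class, `τ_M + ½ ≤ (τ₁ + ½)/a` (and
symmetrically `≤ (τ₂ + ½)/(1 − a)`): a hybrid scheme is never slower, in `τ + ½`, than its best
component for that observable divided by the component's weight — the quantitative licence for
mixing a global (flow) update that decorrelates the slow mode with a local update that decorrelates
everything else.

## What is proved (namespace `RevOp`; `0 ≤ a ≤ 1`)

* `mix_mem`, `mix_add_mul`, `mix_symm`, `mix_contr` — `M` is again in the format (contraction by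
  convexity of the square);
* **`dirichlet_mix_eq`** — `𝓔_M(v) = a 𝓔₁(v) + (1 − a) 𝓔₂(v)`;
  `dirichlet_le_inv_weight_mul_mix` — `𝓔₁(v) ≤ a⁻¹ 𝓔_M(v)` (`𝓔₂ ≥ 0`, `0 < a`);
* **`abelSum_mix_le`** (unconditional): `Σ_k C_M(k) sᵏ ≤ (1 − r + r/a) Σ_k C₁(k) rᵏ`,
  `s = (r/a)/(1 − r + r/a)`, every `g ∈ A`, `0 ≤ r < 1`;
* **`tauInt_mix_add_half_le`** — under the standing summability hypothesis for `K₁` and `M`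
  (`P > 0`):  **`τ_M(g) + ½ ≤ (τ₁(g) + ½)/a`**.
(The statements for the second component follow by exchanging `K₁ ↔ K₂`, `a ↔ 1 − a`.)

NOT CLAIMED: a lower bound on `τ_M` from the components (a mixture can beat both); deterministic
alternation `K₁K₂` (not reversible); any number for any run.
-/

namespace Summit.Ventures.LatticeQCDFlow.Exactness

open Real MeasureTheory Filter Finset Topology
open Summit.Ventures.LatticeQCDFlow.Scoring

namespace RevOp

variable {X : Type*} [MeasurableSpace X] {μ : Measure X} {w : X → ℝ} {A : (X → ℝ) → Prop}
  {K₁ K₂ M : (X → ℝ) → (X → ℝ)} {a : ℝ}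

/-! ## §1 The mixture is again in the format -/

omit [MeasurableSpace X] in
/-- **(stab)**: `A f → A (M f)` for `M f = a K₁ f + (1 − a) K₂ f`. -/
theorem mix_mem (hAc : ∀ ⦃f h : X → ℝ⦄ (c : ℝ), A f → A h → A (fun x => f x + c * h x))
    (hAK₁ : ∀ ⦃f : X → ℝ⦄, A f → A (K₁ f)) (hAK₂ : ∀ ⦃f : X → ℝ⦄, A f → A (K₂ f))
    (hM : ∀ f x, M f x = a * K₁ f x + (1 - a) * K₂ f x) {f : X → ℝ} (hf : A f) : A (M f) := by
  have e : M f = fun x => a * K₁ f x + (1 - a) * K₂ f x := funext (hM f)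
  have h1 : A (fun x => K₁ f x + (a - 1) * K₁ f x) := hAc (a - 1) (hAK₁ hf) (hAK₁ hf)
  have e1 : (fun x => K₁ f x + (a - 1) * K₁ f x) = fun x => a * K₁ f x := funext fun x => by ring
  rw [e1] at h1
  have h2 := hAc (1 - a) h1 (hAK₂ hf)
  rw [e]
  exact h2

omit [MeasurableSpace X] in
/-- **(lin)** for the mixture. -/
theorem mix_add_mul
    (hlin₁ : ∀ ⦃f h : X → ℝ⦄ (c : ℝ), A f → A h →
      ∀ x, K₁ (fun s => f s + c * h s) x = K₁ f x + c * K₁ h x)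
    (hlin₂ : ∀ ⦃f h : X → ℝ⦄ (c : ℝ), A f → A h →
      ∀ x, K₂ (fun s => f s + c * h s) x = K₂ f x + c * K₂ h x)
    (hM : ∀ f x, M f x = a * K₁ f x + (1 - a) * K₂ f x)
    {f h : X → ℝ} (c : ℝ) (hf : A f) (hh : A h) (x : X) :
    M (fun s => f s + c * h s) x = M f x + c * M h x := by
  rw [hM, hM, hM, hlin₁ c hf hh x, hlin₂ c hf hh x]
  ring

/-- **(symm)** for the mixture. -/
theorem mix_symm (hAi : ∀ ⦃f h : X → ℝ⦄, A f → A h → Integrable (fun x => f x * h x * w x) μ)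
    (hAK₁ : ∀ ⦃f : X → ℝ⦄, A f → A (K₁ f)) (hAK₂ : ∀ ⦃f : X → ℝ⦄, A f → A (K₂ f))
    (hsymm₁ : ∀ ⦃f h : X → ℝ⦄, A f → A h →
      ∫ x, K₁ f x * h x * w x ∂μ = ∫ x, f x * K₁ h x * w x ∂μ)
    (hsymm₂ : ∀ ⦃f h : X → ℝ⦄, A f → A h →
      ∫ x, K₂ f x * h x * w x ∂μ = ∫ x, f x * K₂ h x * w x ∂μ)
    (hM : ∀ f x, M f x = a * K₁ f x + (1 - a) * K₂ f x) {f h : X → ℝ} (hf : A f) (hh : A h) :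
    ∫ x, M f x * h x * w x ∂μ = ∫ x, f x * M h x * w x ∂μ := by
  simp only [hM]
  have i1 : Integrable (fun x => a * (K₁ f x * h x * w x)) μ := (hAi (hAK₁ hf) hh).const_mul _
  have i2 : Integrable (fun x => (1 - a) * (K₂ f x * h x * w x)) μ := (hAi (hAK₂ hf) hh).const_mul _
  have i3 : Integrable (fun x => a * (f x * K₁ h x * w x)) μ := (hAi hf (hAK₁ hh)).const_mul _
  have i4 : Integrable (fun x => (1 - a) * (f x * K₂ h x * w x)) μ := (hAi hf (hAK₂ hh)).const_mul _
  have e1 : ∀ x, (a * K₁ f x + (1 - a) * K₂ f x) * h x * w x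
      = a * (K₁ f x * h x * w x) + (1 - a) * (K₂ f x * h x * w x) := fun x => by ring
  have e2 : ∀ x, f x * (a * K₁ h x + (1 - a) * K₂ h x) * w x
      = a * (f x * K₁ h x * w x) + (1 - a) * (f x * K₂ h x * w x) := fun x => by ring
  simp_rw [e1, e2]
  rw [integral_add i1 i2, integral_add i3 i4, integral_const_mul, integral_const_mul,
    integral_const_mul, integral_const_mul, hsymm₁ hf hh, hsymm₂ hf hh]

/-- **(contr)** for the mixture (`0 ≤ a ≤ 1`): convexity of the square. -/
theorem mix_contr (hw0 : ∀ x, 0 ≤ w x)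
    (hAi : ∀ ⦃f h : X → ℝ⦄, A f → A h → Integrable (fun x => f x * h x * w x) μ)
    (hAc : ∀ ⦃f h : X → ℝ⦄ (c : ℝ), A f → A h → A (fun x => f x + c * h x))
    (hAK₁ : ∀ ⦃f : X → ℝ⦄, A f → A (K₁ f)) (hAK₂ : ∀ ⦃f : X → ℝ⦄, A f → A (K₂ f))
    (hcontr₁ : ∀ ⦃f : X → ℝ⦄, A f → ∫ x, K₁ f x ^ 2 * w x ∂μ ≤ ∫ x, f x ^ 2 * w x ∂μ)
    (hcontr₂ : ∀ ⦃f : X → ℝ⦄, A f → ∫ x, K₂ f x ^ 2 * w x ∂μ ≤ ∫ x, f x ^ 2 * w x ∂μ)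
    (hM : ∀ f x, M f x = a * K₁ f x + (1 - a) * K₂ f x)
    (ha0 : 0 ≤ a) (ha1 : a ≤ 1) {f : X → ℝ} (hf : A f) :
    ∫ x, M f x ^ 2 * w x ∂μ ≤ ∫ x, f x ^ 2 * w x ∂μ := by
  have hMf := mix_mem hAc hAK₁ hAK₂ hM hf
  have iM : Integrable (fun x => (a * K₁ f x + (1 - a) * K₂ f x) ^ 2 * w x) μ :=
    (integrable_sq_mul hAi hMf).congr (Eventually.of_forall fun x => by simp only [hM])
  simp only [hM]
  have i1 : Integrable (fun x => K₁ f x ^ 2 * w x) μ := integrable_sq_mul hAi (hAK₁ hf)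
  have i2 : Integrable (fun x => K₂ f x ^ 2 * w x) μ := integrable_sq_mul hAi (hAK₂ hf)
  have hmono : ∫ x, (a * K₁ f x + (1 - a) * K₂ f x) ^ 2 * w x ∂μ
      ≤ ∫ x, (a * (K₁ f x ^ 2 * w x) + (1 - a) * (K₂ f x ^ 2 * w x)) ∂μ := by
    refine integral_mono iM ((i1.const_mul _).add (i2.const_mul _)) fun x => ?_
    show (a * K₁ f x + (1 - a) * K₂ f x) ^ 2 * w x ≤ a * (K₁ f x ^ 2 * w x) + (1 - a) * (K₂ f x ^ 2 * w x)
    have hcvx : (a * K₁ f x + (1 - a) * K₂ f x) ^ 2 ≤ a * K₁ f x ^ 2 + (1 - a) * K₂ f x ^ 2 := by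
      nlinarith [mul_nonneg (mul_nonneg ha0 (sub_nonneg.2 ha1)) (sq_nonneg (K₁ f x - K₂ f x))]
    calc (a * K₁ f x + (1 - a) * K₂ f x) ^ 2 * w x ≤ (a * K₁ f x ^ 2 + (1 - a) * K₂ f x ^ 2) * w x :=
          mul_le_mul_of_nonneg_right hcvx (hw0 x)
      _ = a * (K₁ f x ^ 2 * w x) + (1 - a) * (K₂ f x ^ 2 * w x) := by ring
  rw [integral_add (i1.const_mul _) (i2.const_mul _), integral_const_mul, integral_const_mul] at hmono
  have h1 := hcontr₁ hf
  have h2 := hcontr₂ hf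
  nlinarith [mul_le_mul_of_nonneg_left h1 ha0, mul_le_mul_of_nonneg_left h2 (sub_nonneg.2 ha1)]

/-! ## §2 The Dirichlet form of the mixture -/

/-- **`𝓔_M(v) = a 𝓔₁(v) + (1 − a) 𝓔₂(v)`.** -/
theorem dirichlet_mix_eq (hAi : ∀ ⦃f h : X → ℝ⦄, A f → A h → Integrable (fun x => f x * h x * w x) μ)
    (hAK₁ : ∀ ⦃f : X → ℝ⦄, A f → A (K₁ f)) (hAK₂ : ∀ ⦃f : X → ℝ⦄, A f → A (K₂ f))
    (hM : ∀ f x, M f x = a * K₁ f x + (1 - a) * K₂ f x) {v : X → ℝ} (hv : A v) :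
    (∫ x, v x ^ 2 * w x ∂μ) - ∫ x, v x * M v x * w x ∂μ
      = a * ((∫ x, v x ^ 2 * w x ∂μ) - ∫ x, v x * K₁ v x * w x ∂μ)
        + (1 - a) * ((∫ x, v x ^ 2 * w x ∂μ) - ∫ x, v x * K₂ v x * w x ∂μ) := by
  simp only [hM]
  have i1 : Integrable (fun x => a * (v x * K₁ v x * w x)) μ := (hAi hv (hAK₁ hv)).const_mul _
  have i2 : Integrable (fun x => (1 - a) * (v x * K₂ v x * w x)) μ := (hAi hv (hAK₂ hv)).const_mul _
  have e : ∀ x, v x * (a * K₁ v x + (1 - a) * K₂ v x) * w x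
      = a * (v x * K₁ v x * w x) + (1 - a) * (v x * K₂ v x * w x) := fun x => by ring
  simp_rw [e]
  rw [integral_add i1 i2, integral_const_mul, integral_const_mul]
  ring

/-- **Each component is dominated by the mixture**: `𝓔₁(v) ≤ a⁻¹ · 𝓔_M(v)` (`0 < a ≤ 1`,
`𝓔₂(v) ≥ 0`). -/
theorem dirichlet_le_inv_weight_mul_mix (hw0 : ∀ x, 0 ≤ w x)
    (hAi : ∀ ⦃f h : X → ℝ⦄, A f → A h → Integrable (fun x => f x * h x * w x) μ)
    (hAK₁ : ∀ ⦃f : X → ℝ⦄, A f → A (K₁ f)) (hAK₂ : ∀ ⦃f : X → ℝ⦄, A f → A (K₂ f))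
    (hcontr₂ : ∀ ⦃f : X → ℝ⦄, A f → ∫ x, K₂ f x ^ 2 * w x ∂μ ≤ ∫ x, f x ^ 2 * w x ∂μ)
    (hM : ∀ f x, M f x = a * K₁ f x + (1 - a) * K₂ f x) (ha0 : 0 < a) (ha1 : a ≤ 1)
    {v : X → ℝ} (hv : A v) :
    (∫ x, v x ^ 2 * w x ∂μ) - ∫ x, v x * K₁ v x * w x ∂μ
      ≤ (1 / a) * ((∫ x, v x ^ 2 * w x ∂μ) - ∫ x, v x * M v x * w x ∂μ) := by
  rw [dirichlet_mix_eq hAi hAK₁ hAK₂ hM hv]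
  have hE2 : 0 ≤ (∫ x, v x ^ 2 * w x ∂μ) - ∫ x, v x * K₂ v x * w x ∂μ := by
    have := quadForm_nonneg hw0 hAi hAK₂ hcontr₂ hv zero_le_one le_rfl
    rw [one_mul] at this
    exact this
  set E₁ := (∫ x, v x ^ 2 * w x ∂μ) - ∫ x, v x * K₁ v x * w x ∂μ with hE₁
  set E₂ := (∫ x, v x ^ 2 * w x ∂μ) - ∫ x, v x * K₂ v x * w x ∂μ with hE₂
  calc E₁ = (1 / a) * (a * E₁) := by field_simp
    _ ≤ (1 / a) * (a * E₁ + (1 - a) * E₂) := by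
        refine mul_le_mul_of_nonneg_left ?_ (by positivity)
        nlinarith [mul_nonneg (sub_nonneg.2 ha1) hE2]

/-! ## §3 The mixture inherits the best component -/

/-- **MIXTURE COMPARISON, ABEL FORM (unconditional).**  For every `g ∈ A`, `0 ≤ r < 1`, with
`c = a⁻¹` and `s = r c/(1 − r + r c)`:  `Σ_k C_M(k) sᵏ ≤ (1 − r + r c) · Σ_k C₁(k) rᵏ`. -/
theorem abelSum_mix_le (hw0 : ∀ x, 0 ≤ w x)
    (hAi : ∀ ⦃f h : X → ℝ⦄, A f → A h → Integrable (fun x => f x * h x * w x) μ)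
    (hAc : ∀ ⦃f h : X → ℝ⦄ (c : ℝ), A f → A h → A (fun x => f x + c * h x))
    (hAK₁ : ∀ ⦃f : X → ℝ⦄, A f → A (K₁ f)) (hAK₂ : ∀ ⦃f : X → ℝ⦄, A f → A (K₂ f))
    (hlin₁ : ∀ ⦃f h : X → ℝ⦄ (c : ℝ), A f → A h →
      ∀ x, K₁ (fun s => f s + c * h s) x = K₁ f x + c * K₁ h x)
    (hlin₂ : ∀ ⦃f h : X → ℝ⦄ (c : ℝ), A f → A h →
      ∀ x, K₂ (fun s => f s + c * h s) x = K₂ f x + c * K₂ h x)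
    (hsymm₁ : ∀ ⦃f h : X → ℝ⦄, A f → A h →
      ∫ x, K₁ f x * h x * w x ∂μ = ∫ x, f x * K₁ h x * w x ∂μ)
    (hsymm₂ : ∀ ⦃f h : X → ℝ⦄, A f → A h →
      ∫ x, K₂ f x * h x * w x ∂μ = ∫ x, f x * K₂ h x * w x ∂μ)
    (hcontr₁ : ∀ ⦃f : X → ℝ⦄, A f → ∫ x, K₁ f x ^ 2 * w x ∂μ ≤ ∫ x, f x ^ 2 * w x ∂μ)
    (hcontr₂ : ∀ ⦃f : X → ℝ⦄, A f → ∫ x, K₂ f x ^ 2 * w x ∂μ ≤ ∫ x, f x ^ 2 * w x ∂μ)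
    (hM : ∀ f x, M f x = a * K₁ f x + (1 - a) * K₂ f x) (ha0 : 0 < a) (ha1 : a ≤ 1)
    {g : X → ℝ} (hg : A g) {r : ℝ} (hr0 : 0 ≤ r) (hr1 : r < 1) :
    ∑' k, (∫ x, g x * (M^[k] g) x * w x ∂μ) * (r * (1 / a) / (1 - r + r * (1 / a))) ^ k
      ≤ (1 - r + r * (1 / a)) * ∑' k, (∫ x, g x * (K₁^[k] g) x * w x ∂μ) * r ^ k :=
  abelSum_le_of_dirichlet_le_mul hw0 hAi hAc hAK₁ hlin₁ hsymm₁ hcontr₁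
    (fun _ hf => mix_mem hAc hAK₁ hAK₂ hM hf)
    (fun _ _ c hf hh x => mix_add_mul hlin₁ hlin₂ hM c hf hh x)
    (fun _ _ hf hh => mix_symm hAi hAK₁ hAK₂ hsymm₁ hsymm₂ hM hf hh)
    (fun _ hf => mix_contr hw0 hAi hAc hAK₁ hAK₂ hcontr₁ hcontr₂ hM ha0.le ha1 hf)
    (one_div_pos.2 ha0)
    (fun _ hv => dirichlet_le_inv_weight_mul_mix hw0 hAi hAK₁ hAK₂ hcontr₂ hM ha0 ha1 hv) hg hr0 hr1

/-- **A MIXTURE OF EXACT REVERSIBLE UPDATES INHERITS ITS BEST COMPONENT UP TO THE WEIGHT.**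
`M = a K₁ + (1 − a) K₂` (`0 < a ≤ 1`), `g ∈ A` with `C_g(0) > 0`, normalised autocorrelation series
summable under `K₁` and under `M`.  Then  `τ_M(g) + ½ ≤ (τ₁(g) + ½) / a`. -/
theorem tauInt_mix_add_half_le (hw0 : ∀ x, 0 ≤ w x)
    (hAi : ∀ ⦃f h : X → ℝ⦄, A f → A h → Integrable (fun x => f x * h x * w x) μ)
    (hAc : ∀ ⦃f h : X → ℝ⦄ (c : ℝ), A f → A h → A (fun x => f x + c * h x))
    (hAK₁ : ∀ ⦃f : X → ℝ⦄, A f → A (K₁ f)) (hAK₂ : ∀ ⦃f : X → ℝ⦄, A f → A (K₂ f))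
    (hlin₁ : ∀ ⦃f h : X → ℝ⦄ (c : ℝ), A f → A h →
      ∀ x, K₁ (fun s => f s + c * h s) x = K₁ f x + c * K₁ h x)
    (hlin₂ : ∀ ⦃f h : X → ℝ⦄ (c : ℝ), A f → A h →
      ∀ x, K₂ (fun s => f s + c * h s) x = K₂ f x + c * K₂ h x)
    (hsymm₁ : ∀ ⦃f h : X → ℝ⦄, A f → A h →
      ∫ x, K₁ f x * h x * w x ∂μ = ∫ x, f x * K₁ h x * w x ∂μ)
    (hsymm₂ : ∀ ⦃f h : X → ℝ⦄, A f → A h →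
      ∫ x, K₂ f x * h x * w x ∂μ = ∫ x, f x * K₂ h x * w x ∂μ)
    (hcontr₁ : ∀ ⦃f : X → ℝ⦄, A f → ∫ x, K₁ f x ^ 2 * w x ∂μ ≤ ∫ x, f x ^ 2 * w x ∂μ)
    (hcontr₂ : ∀ ⦃f : X → ℝ⦄, A f → ∫ x, K₂ f x ^ 2 * w x ∂μ ≤ ∫ x, f x ^ 2 * w x ∂μ)
    (hM : ∀ f x, M f x = a * K₁ f x + (1 - a) * K₂ f x) (ha0 : 0 < a) (ha1 : a ≤ 1)
    {g : X → ℝ} (hg : A g) (hP : 0 < ∫ x, g x ^ 2 * w x ∂μ)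
    (hs₁ : Summable fun n => (∫ x, g x * (K₁^[n + 1] g) x * w x ∂μ) / ∫ x, g x ^ 2 * w x ∂μ)
    (hsM : Summable fun n => (∫ x, g x * (M^[n + 1] g) x * w x ∂μ) / ∫ x, g x ^ 2 * w x ∂μ) :
    tauInt (fun n => (∫ x, g x * (M^[n] g) x * w x ∂μ) / ∫ x, g x ^ 2 * w x ∂μ) + 1 / 2
      ≤ (tauInt (fun n => (∫ x, g x * (K₁^[n] g) x * w x ∂μ) / ∫ x, g x ^ 2 * w x ∂μ) + 1 / 2)
        / a := by
  have h := tauInt_add_half_le_of_dirichlet_le_mul hw0 hAi hAc hAK₁ hlin₁ hsymm₁ hcontr₁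
    (fun _ hf => mix_mem hAc hAK₁ hAK₂ hM hf)
    (fun _ _ c hf hh x => mix_add_mul hlin₁ hlin₂ hM c hf hh x)
    (fun _ _ hf hh => mix_symm hAi hAK₁ hAK₂ hsymm₁ hsymm₂ hM hf hh)
    (one_div_pos.2 ha0)
    (fun _ hv => dirichlet_le_inv_weight_mul_mix hw0 hAi hAK₁ hAK₂ hcontr₂ hM ha0 ha1 hv) hg hP hs₁ hsM
  have e : ∀ x : ℝ, x / a = (1 / a) * x := fun x => by ring
  rw [e]
  exact h

end RevOp

end Summit.Ventures.LatticeQCDFlow.Exactness
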